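import Summits.CriticalPhenomena.PercolationContinuityZ3.Theorems.PercNearOneGluingNoHeavyLowerTailSunflowerGraphCoreTriangle
import Mathlib.Combinatorics.SimpleGraph.Maps
import Mathlib.MeasureTheory.MeasurableSpace.Pi
import HarnessLib

/-!
# `NoHeavyLowerTail` (crux stmt-CriticalPhenomena-4575), abstract sunflower cubic: SAFETY IS INVARIANT UNDER BLOW-UP
# (OR-substitution of fresh coordinates; twins; the conjecture `TriangleFreeSafe` reduces to twin-free graphs)

Support file (seat `prim-ineq-prove-1` gen 42; `--supports stmt-CriticalPhenomena-4575`).  No `sorry`, no named facts.  Memo: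
run/shared/lean/prim/prim-ineq-prove-1/FINDING-BLOWUP-prove1-g42.md.

SETTING.  `μ_p = prodBernoulli p` on `Set ι` (`ι` finite); `SafeCalc.Safe p A` = Lemma A in product form for every sunflower of
up-sets with pairwise intersections inside the core `A` (`…SunflowerSafeCalculus`); the graph core `edgeCore Γ` of a simple graph
(`…SunflowerGraphCoreTriangle`), and the typed conjecture `TriangleFreeSafe` ("every triangle-free graph has an A-safe graph core";
theorem for bipartite graphs, `…SunflowerBipartiteSafe`; exact census: all graphs on `≤ 8` vertices).

THE OR-AGGREGATION MAP.  For `f : ι → κ` let `orMap f ω = f '' ω` ("which blocks of `f` are hit") and `orParam f p y =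
1 − ∏_{f x = y} (1 − p x)`.  Under `μ_p` the hit vector has law `μ_{orParam f p}` (`map_orMap_prodBernoulli`, via the π-system of the
cylinders "no block of `F` is hit", `generateFrom_cylinders_eq`).
**THEOREM (`safe_preimage_orMap`, OR-substitution).  For every up-set `B ⊆ Set κ`: `Safe (orParam f p) B → Safe p (orMap f ⁻¹' B)`**
(replacing each variable of a safe monotone core by the OR of a fresh block of independent variables gives a safe core).  PROOF: push a
petal `V` forward to the up-set `W = {S | f ⁻¹' S ∈ V}`; `V ⊆ orMap f ⁻¹' W`; two pushed petals meet inside `B` because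
`f ⁻¹' S ∈ V i ∩ V j ⊆ orMap f ⁻¹' B` gives `f '' (f ⁻¹' S) ∈ B`, a subset of `S`; so `∏ μ_p(V i) ≤ ∏ μ_q(W i) ≤ μ_q(B)^{n−1} =
μ_p(orMap f ⁻¹' B)^{n−1}`.
**GRAPH CORES.**  The graph core of the pull-back graph `Δ.comap f` (`u ~ v ↔ f u ~ f v`: the BLOW-UP of `Δ` replacing each vertex
`y` by the independent set `f ⁻¹ y`, classes of adjacent vertices completely joined) is `orMap f ⁻¹' edgeCore Δ` (`edgeCore_comap`);
hence **A-safety is invariant under blow-up** (`aSafe_edgeCore_comap`; `aSafe_comap_iff` for surjective `f`), adding a TWIN of a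
vertex preserves A-safety (`safe_edgeCore_of_fold`, `safe_edgeCore_of_twin`: fold `x' ↦ x`, the class carrying
`1 − (1 − p x)(1 − p x')`), every graph is the blow-up of its twin quotient (`twinQuotient_comap_mk`), and **`TriangleFreeSafe` is
equivalent to its restriction to twin-free triangle-free graphs** (`triangleFreeSafe_iff_twinFree`).  Consequences (memo): every
blow-up of the pentagon is A-safe (`…SunflowerBlowupPentagon`); the census "all graphs on `≤ 8` vertices" covers every graph whose
twin quotient has `≤ 8` vertices; the large-twin-class regime that refutes the fibre-wise certificate LLI
(`…SunflowerLocalLoadRefutation`) cannot refute `TriangleFreeSafe`.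
-/

noncomputable section

namespace Summit.CriticalPhenomena.PercolationContinuityZ3.Theorems.SunflowerPartition

namespace SafeCalc

open MeasureTheory Finset
open Literature.Probability.LatticeModels Literature.Probability.Percolation

variable {ι κ : Type*} [Fintype ι] [Fintype κ]

/-! ## The OR-aggregation map and the aggregated parameter -/

/-- The OR-aggregation ("hit") map along `f : ι → κ`: the set of `f`-blocks met by `ω`, i.e. the image `f '' ω`. [this work] -/
def orMap (f : ι → κ) (ω : Set ι) : Set κ := f '' ω

/-- The OR-aggregated parameter: block `y` is hit with probability `1 − ∏_{f x = y} (1 − p x)`. [this work] -/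
def orParam (f : ι → κ) (p : ι → unitInterval) (y : κ) : unitInterval := by
  classical
  exact unitInterval.symm
    ⟨∏ x ∈ univ.filter (fun x => f x = y), (1 - (p x : ℝ)),
      Finset.prod_nonneg fun x _ => sub_nonneg.2 (p x).2.2,
      Finset.prod_le_one (fun x _ => sub_nonneg.2 (p x).2.2) fun x _ => sub_le_self _ (p x).2.1⟩

omit [Fintype κ] in
/-- `1 − orParam f p y = ∏_{f x = y} (1 − p x)`. [this work] -/
theorem one_sub_orParam [DecidableEq κ] (f : ι → κ) (p : ι → unitInterval) (y : κ) :
    1 - (orParam f p y : ℝ) = ∏ x ∈ univ.filter (fun x => f x = y), (1 - (p x : ℝ)) := by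
  unfold orParam
  rw [unitInterval.coe_symm_eq, sub_sub_cancel]
  exact Finset.prod_congr (by ext; simp) fun _ _ => rfl

omit [Fintype κ] in
/-- The pull-back of the cylinder "no block of `F` is hit" is the cylinder "no coordinate over `F` is open". [this work] -/
theorem orMap_preimage_forall_notMem (f : ι → κ) (F : Finset κ) [DecidablePred fun x => f x ∈ F] :
    orMap f ⁻¹' {S : Set κ | ∀ y ∈ F, y ∉ S} = {ω : Set ι | ∀ x ∈ univ.filter (fun x => f x ∈ F), x ∉ ω} := by
  ext ω
  simp only [orMap, Set.mem_preimage, Set.mem_setOf_eq, Set.mem_image, not_exists, not_and, mem_filter, mem_univ,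
    true_and]
  constructor
  · intro h x hx hxω
    exact h (f x) hx x hxω rfl
  · intro h y hy x hxω hfx
    exact h x (hfx ▸ hy) hxω

omit [Fintype κ] in
/-- `∏_{y ∈ F} (1 − orParam f p y) = ∏_{f x ∈ F} (1 − p x)`. [this work] -/
theorem prod_one_sub_orParam [DecidableEq κ] (f : ι → κ) (p : ι → unitInterval) (F : Finset κ) :
    ∏ y ∈ F, (1 - (orParam f p y : ℝ)) = ∏ x ∈ univ.filter (fun x => f x ∈ F), (1 - (p x : ℝ)) := by
  simp_rw [one_sub_orParam]
  rw [← Finset.prod_fiberwise_of_maps_to (s := univ.filter fun x => f x ∈ F) (t := F) (g := f)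
    (fun x hx => (mem_filter.1 hx).2) (fun x => 1 - (p x : ℝ))]
  refine Finset.prod_congr rfl fun y hy => Finset.prod_congr ?_ fun _ _ => rfl
  ext x
  simp only [mem_filter, mem_univ, true_and]
  exact ⟨fun h => ⟨h ▸ hy, h⟩, fun h => h.2⟩

/-! ## The law of the hit vector -/

/-- The cylinders "no block of `F` is hit" generate the σ-algebra of `Set κ` (`κ` finite). [this work] -/
theorem generateFrom_cylinders_eq :
    MeasurableSpace.generateFrom (Set.range fun F : Finset κ => {S : Set κ | ∀ y ∈ F, y ∉ S}) =
      (Set.instMeasurableSpace : MeasurableSpace (Set κ)) := by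
  classical
  refine le_antisymm (MeasurableSpace.generateFrom_le ?_) ?_
  · rintro _ ⟨F, rfl⟩
    exact MeasurableSet.of_discrete
  · -- the σ-algebra of `Set κ = κ → Prop` is generated by the coordinate projections
    change MeasurableSpace.pi ≤ _
    rw [MeasurableSpace.pi_eq_generateFrom_projections]
    refine MeasurableSpace.generateFrom_le ?_
    rintro _ ⟨y, A, -, rfl⟩
    -- the generator `{S | y ∉ S}` and its complement `{S | y ∈ S}` are measurable
    have hnot : MeasurableSet[MeasurableSpace.generateFrom
        (Set.range fun F : Finset κ => {S : Set κ | ∀ y ∈ F, y ∉ S})] {S : Set κ | y ∉ S} := by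
      refine MeasurableSpace.measurableSet_generateFrom ⟨{y}, ?_⟩
      ext S
      simp
    have hmem : MeasurableSet[MeasurableSpace.generateFrom
        (Set.range fun F : Finset κ => {S : Set κ | ∀ y ∈ F, y ∉ S})] {S : Set κ | y ∈ S} := by
      have : {S : Set κ | y ∈ S} = {S : Set κ | y ∉ S}ᶜ := by ext S; simp
      rw [this]
      exact hnot.compl
    -- `eval y ⁻¹' A` is one of `∅, {y ∈ S}, {y ∉ S}, univ`
    have hA : (Function.eval y ⁻¹' A : Set (κ → Prop)) =
        ({S : Set κ | y ∈ S} ∩ {_S | True ∈ A}) ∪ ({S : Set κ | y ∉ S} ∩ {_S | False ∈ A}) := by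
      ext S
      simp only [Set.mem_preimage, Function.eval]
      by_cases hy : S y
      · rw [eq_true hy]
        exact ⟨fun h => Or.inl ⟨hy, h⟩, fun h => h.elim And.right fun h' => (h'.1 hy).elim⟩
      · rw [eq_false hy]
        exact ⟨fun h => Or.inr ⟨hy, h⟩, fun h => h.elim (fun h' => (hy h'.1).elim) And.right⟩
    rw [hA]
    exact (hmem.inter (MeasurableSet.const _)).union (hnot.inter (MeasurableSet.const _))

/-- **The law of the hit vector.**  Under `μ_p` the hit vector `orMap f ω = f '' ω` is distributed as `μ_{orParam f p}`:
the blocks are hit independently, block `y` with probability `1 − ∏_{f x = y} (1 − p x)`. [this work] -/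
theorem map_orMap_prodBernoulli (f : ι → κ) (p : ι → unitInterval) :
    (prodBernoulli p).map (orMap f) = prodBernoulli (orParam f p) := by
  classical
  haveI : IsProbabilityMeasure ((prodBernoulli p).map (orMap f)) :=
    Measure.isProbabilityMeasure_map (Measurable.of_discrete (f := orMap f)).aemeasurable
  refine ext_of_generate_finite (Set.range fun F : Finset κ => {S : Set κ | ∀ y ∈ F, y ∉ S})
    generateFrom_cylinders_eq.symm ?_ ?_ (by rw [measure_univ, measure_univ])
  · -- the cylinders form a π-system
    rintro _ ⟨F, rfl⟩ _ ⟨G, rfl⟩ -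
    refine ⟨F ∪ G, ?_⟩
    ext S
    simp only [Set.mem_setOf_eq, Set.mem_inter_iff, Finset.mem_union]
    exact ⟨fun h => ⟨fun y hy => h y (Or.inl hy), fun y hy => h y (Or.inr hy)⟩,
      fun h y hy => hy.elim (h.1 y) (h.2 y)⟩
  · rintro _ ⟨F, rfl⟩
    rw [Measure.map_apply (Measurable.of_discrete (f := orMap f)) MeasurableSet.of_discrete,
      orMap_preimage_forall_notMem, ← ofReal_measureReal (measure_ne_top _ _),
      ← ofReal_measureReal (measure_ne_top _ _), prodBernoulli_real_forall_notMem, prodBernoulli_real_forall_notMem,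
      prod_one_sub_orParam]

/-- **Pull-back of events along the hit map**: `μ_p(orMap f ⁻¹' B) = μ_{orParam f p}(B)`. [this work] -/
theorem real_preimage_orMap (f : ι → κ) (p : ι → unitInterval) (B : Set (Set κ)) :
    (prodBernoulli p).real (orMap f ⁻¹' B) = (prodBernoulli (orParam f p)).real B := by
  rw [measureReal_def, measureReal_def,
    ← Measure.map_apply (Measurable.of_discrete (f := orMap f)) MeasurableSet.of_discrete, map_orMap_prodBernoulli]

/-! ## The OR-substitution principle -/

/-- **OR-SUBSTITUTION PRINCIPLE.**  If the up-set `B ⊆ Set κ` is safe for the aggregated parameter `orParam f p`, then its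
pull-back `orMap f ⁻¹' B` ("`B` holds for the hit vector"; = `B` with every variable `y` replaced by the OR of the fresh block
`f ⁻¹ y`) is safe for `p`. [this work] -/
theorem safe_preimage_orMap (f : ι → κ) (p : ι → unitInterval) {B : Set (Set κ)} (hB : IsUpperSet B)
    (hsafe : Safe (orParam f p) B) : Safe p (orMap f ⁻¹' B) := by
  intro n V hV hcap
  -- push the petals forward along the hit map
  set W : Fin n → Set (Set κ) := fun i => {S | f ⁻¹' S ∈ V i} with hW
  have hWup : ∀ i, IsUpperSet (W i) := fun i S S' hle hS => hV i (Set.preimage_mono hle) hS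
  have hWcap : ∀ i j, i ≠ j → W i ∩ W j ⊆ B := by
    intro i j hij S hS
    have h1 : f ⁻¹' S ∈ orMap f ⁻¹' B := hcap i j hij hS
    exact hB (Set.image_preimage_subset f S) h1
  have hsub : ∀ i, V i ⊆ orMap f ⁻¹' W i := fun i ω hω => hV i (Set.subset_preimage_image f ω) hω
  calc ∏ i, (prodBernoulli p).real (V i)
      ≤ ∏ i, (prodBernoulli p).real (orMap f ⁻¹' W i) :=
        Finset.prod_le_prod (fun i _ => measureReal_nonneg) fun i _ => measureReal_mono (hsub i)
    _ = ∏ i, (prodBernoulli (orParam f p)).real (W i) := by simp_rw [real_preimage_orMap]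
    _ ≤ ((prodBernoulli (orParam f p)).real B) ^ (n - 1) := hsafe n W hWup hWcap
    _ = ((prodBernoulli p).real (orMap f ⁻¹' B)) ^ (n - 1) := by rw [real_preimage_orMap]

/-! ## Graph cores: blow-ups and twins -/

omit [Fintype ι] [Fintype κ] in
/-- The graph core of the pull-back graph `Δ.comap f` (`u ~ v ↔ f u ~ f v`, the blow-up of `Δ` along `f`) is the pull-back of
the graph core of `Δ` along the hit map. [this work] -/
theorem edgeCore_comap (f : ι → κ) (Δ : SimpleGraph κ) : edgeCore (Δ.comap f) = orMap f ⁻¹' edgeCore Δ := by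
  ext ω
  simp only [edgeCore, SimpleGraph.comap_adj, Set.mem_setOf_eq, Set.mem_preimage, orMap, Set.mem_image]
  constructor
  · rintro ⟨u, v, huv, hu, hv⟩
    exact ⟨f u, f v, huv, ⟨u, hu, rfl⟩, ⟨v, hv, rfl⟩⟩
  · rintro ⟨_, _, huv, ⟨u, hu, rfl⟩, ⟨v, hv, rfl⟩⟩
    exact ⟨u, v, huv, hu, hv⟩

/-- **Blow-up, one parameter.**  Safety of the graph core of `Δ` at the aggregated parameter gives safety of the graph core
of the blow-up `Δ.comap f` at `p`. [this work] -/
theorem safe_edgeCore_comap (f : ι → κ) (Δ : SimpleGraph κ) (p : ι → unitInterval)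
    (h : Safe (orParam f p) (edgeCore Δ)) : Safe p (edgeCore (Δ.comap f)) := by
  rw [edgeCore_comap]
  exact safe_preimage_orMap f p (isUpperSet_edgeCore Δ) h

/-- **A-SAFETY IS INVARIANT UNDER BLOW-UP.**  If the graph core of `Δ` is A-safe (safe for every parameter vector) then so is
the graph core of every blow-up `Δ.comap f` (`f` arbitrary: blow-ups of induced subgraphs included). [this work] -/
theorem aSafe_edgeCore_comap (f : ι → κ) (Δ : SimpleGraph κ) (h : ∀ q : κ → unitInterval, Safe q (edgeCore Δ))
    (p : ι → unitInterval) : Safe p (edgeCore (Δ.comap f)) :=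
  safe_edgeCore_comap f Δ p (h _)

/-- For a surjective blow-up map the converse holds as well: `Δ` is the pull-back of `Δ.comap f` along any section of `f`,
so **A-safety of `Δ` and of its blow-up are equivalent**. [this work] -/
theorem aSafe_comap_iff (f : ι → κ) (hf : Function.Surjective f) (Δ : SimpleGraph κ) :
    (∀ p : ι → unitInterval, Safe p (edgeCore (Δ.comap f))) ↔ ∀ q : κ → unitInterval, Safe q (edgeCore Δ) := by
  refine ⟨fun h q => ?_, fun h p => aSafe_edgeCore_comap f Δ h p⟩
  obtain ⟨s, hs⟩ := hf.hasRightInverse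
  have hΔ : (Δ.comap f).comap s = Δ := by
    ext u v
    simp only [SimpleGraph.comap_adj, hs u, hs v]
  rw [← hΔ]
  exact aSafe_edgeCore_comap s (Δ.comap f) h q

/-- **FOLDING.**  If `r : ι → ι` respects adjacency exactly (`Γ.Adj u v ↔ Γ.Adj (r u) (r v)`; e.g. `r` sends some vertices to
twins of theirs and fixes the rest) then `Γ = Γ.comap r`, so safety of the graph core at the folded parameter `orParam r p` (a
vertex `y` of the range carries `1 − ∏_{r x = y} (1 − p x)`, the folded-away vertices carry `0`) implies safety at `p`. [this work] -/
theorem safe_edgeCore_of_fold (Γ : SimpleGraph ι) (r : ι → ι) (hr : ∀ u v, Γ.Adj u v ↔ Γ.Adj (r u) (r v))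
    (p : ι → unitInterval) (h : Safe (orParam r p) (edgeCore Γ)) : Safe p (edgeCore Γ) := by
  have hΓ : Γ.comap r = Γ := by
    ext u v
    rw [SimpleGraph.comap_adj]
    exact (hr u v).symm
  have h' := safe_edgeCore_comap r Γ p h
  rwa [hΓ] at h'

/-- The twin fold: `x' ↦ x`, everything else fixed. [this work] -/
def twinFold [DecidableEq ι] (x x' : ι) : ι → ι := Function.update id x' x

omit [Fintype ι] in
/-- The twin fold respects adjacency exactly when `x` and `x'` have the same neighbours. [this work] -/
theorem adj_twinFold_iff [DecidableEq ι] (Γ : SimpleGraph ι) {x x' : ι} (htwin : ∀ w, Γ.Adj x w ↔ Γ.Adj x' w) (u v : ι) :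
    Γ.Adj u v ↔ Γ.Adj (twinFold x x' u) (twinFold x x' v) := by
  unfold twinFold
  by_cases hu : u = x' <;> by_cases hv : v = x'
  · subst hu; subst hv
    simp only [Function.update_self, SimpleGraph.irrefl]
  · subst hu
    rw [Function.update_self, Function.update_of_ne hv, id, htwin]
  · subst hv
    rw [Function.update_self, Function.update_of_ne hu, id, Γ.adj_comm, Γ.adj_comm u x, htwin]
  · rw [Function.update_of_ne hu, Function.update_of_ne hv, id, id]

/-- **TWINS.**  If `x'` is a twin of `x` (same neighbourhood; then `x ≁ x'` automatically), safety of the graph core at the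
folded parameter `orParam (twinFold x x') p` — for `x ≠ x'`: `0` at `x'`, `1 − (1 − p x)(1 − p x')` at `x`, `p` elsewhere, i.e. a
parameter vector of the graph with `x'` deleted — implies safety at `p`.  Hence adding twins preserves A-safety, and the
A-safety of a graph depends only on its twin-free quotient. [this work] -/
theorem safe_edgeCore_of_twin [DecidableEq ι] (Γ : SimpleGraph ι) {x x' : ι} (htwin : ∀ w, Γ.Adj x w ↔ Γ.Adj x' w)
    (p : ι → unitInterval) (h : Safe (orParam (twinFold x x') p) (edgeCore Γ)) : Safe p (edgeCore Γ) :=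
  safe_edgeCore_of_fold Γ (twinFold x x') (adj_twinFold_iff Γ htwin) p h

/-- The folded parameter vanishes at the folded-away twin `x'` (`x ≠ x'`): it is a parameter vector "of `Γ − x'`". [this work] -/
theorem orParam_twinFold_self [DecidableEq ι] {x x' : ι} (hne : x ≠ x') (p : ι → unitInterval) :
    orParam (twinFold x x') p x' = 0 := by
  have h1 := one_sub_orParam (twinFold x x') p x'
  have hempty : univ.filter (fun z => twinFold x x' z = x') = ∅ := by
    refine Finset.filter_eq_empty_iff.2 fun z _ hz => ?_
    unfold twinFold at hz
    by_cases hzx : z = x'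
    · subst hzx
      rw [Function.update_self] at hz
      exact hne hz
    · rw [Function.update_of_ne hzx, id] at hz
      exact hzx hz
  rw [hempty, Finset.prod_empty, sub_eq_self] at h1
  exact Subtype.ext (by exact_mod_cast h1)

/-- The folded parameter at the kept twin `x` (`x ≠ x'`) is `1 − (1 − p x)(1 − p x')`. [this work] -/
theorem orParam_twinFold_kept [DecidableEq ι] {x x' : ι} (hne : x ≠ x') (p : ι → unitInterval) :
    (orParam (twinFold x x') p x : ℝ) = 1 - (1 - p x) * (1 - p x') := by
  have h1 := one_sub_orParam (twinFold x x') p x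
  have hpair : univ.filter (fun z => twinFold x x' z = x) = {x, x'} := by
    ext z
    simp only [mem_filter, mem_univ, true_and, Finset.mem_insert, Finset.mem_singleton]
    unfold twinFold
    by_cases hzx : z = x'
    · subst hzx
      simp only [Function.update_self, or_true]
    · rw [Function.update_of_ne hzx, id]
      simp only [hzx, or_false]
  rw [hpair, Finset.prod_pair hne] at h1
  linarith

/-- The folded parameter at any other vertex is unchanged. [this work] -/
theorem orParam_twinFold_of_ne [DecidableEq ι] {x x' z : ι} (hzx : z ≠ x) (hzx' : z ≠ x') (p : ι → unitInterval) :
    orParam (twinFold x x') p z = p z := by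
  have h1 := one_sub_orParam (twinFold x x') p z
  have hsing : univ.filter (fun w => twinFold x x' w = z) = {z} := by
    ext w
    simp only [mem_filter, mem_univ, true_and, Finset.mem_singleton]
    unfold twinFold
    by_cases hwx : w = x'
    · subst hwx
      simp only [Function.update_self]
      exact ⟨fun h => (hzx h.symm).elim, fun h => (hzx' h.symm).elim⟩
    · rw [Function.update_of_ne hwx, id]
  rw [hsing, Finset.prod_singleton] at h1
  exact Subtype.ext (by linarith)


/-! ## The conjecture reduces to twin-free graphs -/

/-- A graph is **twin-free** (point-determining) when distinct vertices have distinct neighbourhoods. [this work] -/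
def TwinFree {V : Type*} (Γ : SimpleGraph V) : Prop := ∀ u v : V, (∀ w, Γ.Adj u w ↔ Γ.Adj v w) → u = v

/-- The twin relation "same neighbourhood" as a setoid. [this work] -/
def twinSetoid {V : Type*} (Γ : SimpleGraph V) : Setoid V where
  r u v := ∀ w, Γ.Adj u w ↔ Γ.Adj v w
  iseqv := ⟨fun _ _ => Iff.rfl, fun h w => (h w).symm, fun h₁ h₂ w => (h₁ w).trans (h₂ w)⟩

/-- The **twin quotient** of a graph: vertices = twin classes, two classes adjacent iff their members are. [this work] -/
def twinQuotient {V : Type*} (Γ : SimpleGraph V) : SimpleGraph (Quotient (twinSetoid Γ)) where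
  Adj := Quotient.lift₂ (fun u v => Γ.Adj u v) (by
    intro u₁ v₁ u₂ v₂ hu hv
    have hu' : ∀ w, Γ.Adj u₁ w ↔ Γ.Adj u₂ w := hu
    have hv' : ∀ w, Γ.Adj v₁ w ↔ Γ.Adj v₂ w := hv
    refine propext ((hu' v₁).trans ?_)
    rw [Γ.adj_comm u₂ v₁, Γ.adj_comm u₂ v₂]
    exact hv' u₂)
  symm := ⟨fun a b => Quotient.inductionOn₂ a b fun _ _ h => Γ.adj_symm h⟩
  loopless := ⟨fun a => Quotient.inductionOn a fun _ h => Γ.irrefl h⟩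

/-- The graph is the blow-up of its twin quotient along the quotient map. [this work] -/
theorem twinQuotient_comap_mk {V : Type*} (Γ : SimpleGraph V) :
    (twinQuotient Γ).comap (Quotient.mk (twinSetoid Γ)) = Γ := by
  ext u v
  rfl

/-- The twin quotient is twin-free. [this work] -/
theorem twinFree_twinQuotient {V : Type*} (Γ : SimpleGraph V) : TwinFree (twinQuotient Γ) := by
  intro a b
  refine Quotient.inductionOn₂ a b fun u v h => ?_
  exact Quotient.sound fun w => h (Quotient.mk _ w)

/-- The twin quotient of a triangle-free graph is triangle-free. [this work] -/
theorem cliqueFree_three_twinQuotient {V : Type*} [DecidableEq V] (Γ : SimpleGraph V) (h : Γ.CliqueFree 3) :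
    (twinQuotient Γ).CliqueFree 3 := by
  classical
  intro t ht
  rw [SimpleGraph.is3Clique_iff] at ht
  obtain ⟨a, b, c, hab, hac, hbc, -⟩ := ht
  obtain ⟨u, rfl⟩ := Quotient.exists_rep a
  obtain ⟨v, rfl⟩ := Quotient.exists_rep b
  obtain ⟨w, rfl⟩ := Quotient.exists_rep c
  exact h {u, v, w} (SimpleGraph.is3Clique_triple_iff.2 ⟨hab, hac, hbc⟩)

/-- **`TriangleFreeSafe` IS EQUIVALENT TO ITS TWIN-FREE RESTRICTION**: every graph is the blow-up of its twin quotient (a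
twin-free graph, triangle-free when the graph is), and A-safety is invariant under blow-up. [this work] -/
theorem triangleFreeSafe_iff_twinFree :
    TriangleFreeSafe ↔ ∀ (n : ℕ) (Γ : SimpleGraph (Fin n)), Γ.CliqueFree 3 → TwinFree Γ →
      ∀ p : Fin n → unitInterval, Safe p (edgeCore Γ) := by
  refine ⟨fun h n Γ h3 _ p => h n Γ h3 p, fun h n Γ h3 p => ?_⟩
  classical
  -- the twin quotient, transported to `Fin m`
  let e : Quotient (twinSetoid Γ) ≃ Fin (Fintype.card (Quotient (twinSetoid Γ))) := Fintype.equivFin _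
  let Δ : SimpleGraph (Fin (Fintype.card (Quotient (twinSetoid Γ)))) := (twinQuotient Γ).comap e.symm
  have hΓ : Δ.comap (e ∘ Quotient.mk (twinSetoid Γ)) = Γ := by
    ext u v
    simp only [Δ, SimpleGraph.comap_adj, Function.comp_apply, Equiv.symm_apply_apply]
    rfl
  have hΔ3 : Δ.CliqueFree 3 :=
    SimpleGraph.CliqueFree.comap (SimpleGraph.Embedding.comap e.symm.toEmbedding (twinQuotient Γ)).isContained
      (cliqueFree_three_twinQuotient Γ h3)
  have hΔtf : TwinFree Δ := by
    intro a b hab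
    apply e.symm.injective
    refine twinFree_twinQuotient Γ _ _ fun w => ?_
    have hw := hab (e w)
    simp only [Δ, SimpleGraph.comap_adj, Equiv.symm_apply_apply] at hw
    exact hw
  rw [← hΓ]
  exact aSafe_edgeCore_comap _ Δ (h _ Δ hΔ3 hΔtf) p

/-- **A-safety passes to induced subgraphs**: a graph embedding `Γ ↪g Δ` (adjacency reflected, i.e. `Γ` is an induced subgraph of
`Δ` up to isomorphism) exhibits `Γ` as the pull-back `Δ.comap f`, so A-safety of `Δ` gives A-safety of `Γ`. [this work] -/
theorem aSafe_of_embedding {V W : Type*} [Fintype V] [Fintype W] {Γ : SimpleGraph V} {Δ : SimpleGraph W} (f : Γ ↪g Δ)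
    (h : ∀ q : W → unitInterval, Safe q (edgeCore Δ)) (p : V → unitInterval) : Safe p (edgeCore Γ) := by
  have hΓ : Δ.comap f = Γ := by
    ext u v
    exact f.map_adj_iff
  rw [← hΓ]
  exact aSafe_edgeCore_comap f Δ h p

end SafeCalc

end Summit.CriticalPhenomena.PercolationContinuityZ3.Theorems.SunflowerPartition
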